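import Mathlib.Analysis.Complex.BranchLogRoot
import Mathlib.Analysis.SpecialFunctions.Complex.LogDeriv
import Literature.Topology.PlaneTopology.SquareRootContinua
import Literature.Probability.RandomPlanarGeometry.ArmComplementTopology
import Literature.Probability.RandomPlanarGeometry.ConformalMap
import HarnessLib

/-!
# The remaining domain of an arm: Koebe's square root and the boundary cover

Topic `Probability/RandomPlanarGeometry`; second support file for `ArmComplementBoundary` (the
continuity theorem for conformal maps `φ : ℍ → Ĉ(η; ∞)` onto the remaining domain of an arm `η`
from `∞` to `0`). The unbounded domain `Ĉ(η; ∞) = armComplement η ⊆ ℂ ∖ ({0} ∪ η)` is made bounded by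
**Koebe's square-root trick** followed by a Möbius inversion: a holomorphic `r` with `r² = φ`
(`exists_differentiableOn_sq_eq`: a continuous logarithm of the non-vanishing `φ` on the simply
connected `ℍ`, Mathlib's `Complex.exists_continuousOn_eqOn_exp_comp`, is holomorphic), whose image
`Q` misses `-Q`, and `M(v) = 1/(v - p)` with `p ∈ -Q`. The boundary of `M(Q)` then lies in the image
of the square-root preimage `{v | v² ∈ {0} ∪ η}` of the closed arm, closed up at `0 = M(∞)`; this
file builds that **boundary cover** and proves it is uniformly locally connected
(`isUniformlyLocallyConnected_armCover`): the half `{0} ∪ η([0, ∞))` of the arm is a compact curve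
through the branch point `0`, so its square-root preimage is uniformly locally connected
(`Literature.Topology.PlaneTopology.IsUniformlyLocallyConnected.setOf_sq_mem_image_Icc`) and so is
its image under the injective `M`; the half `η((-∞, 0])` through `∞` is handled in the coordinate
`u = 1/v`, where it becomes the compact curve `{0} ∪ 1/η((-∞, 0])` through `0` and `M` becomes
`u ↦ u / (1 - p u)`; the two compact pieces are joined by
`Literature.Topology.PlaneTopology.IsUniformlyLocallyConnected.union`. `mem_armCover_of_sq_mem`
records that the cover contains `M(v)` for every `v` over the closed arm, and `0`.

## References

* Ch. Pommerenke, *Boundary Behaviour of Conformal Maps* (1992), §2.2, Thm 2.1. [PommerenkeBBCM1992]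
* P. Koebe's square-root trick: L. V. Ahlfors, *Complex Analysis* (1979), Ch. 6 §1.1. [AhlforsCA1979]
-/

noncomputable section

open Set Filter Topology Metric Bornology Complex
open UpperHalfPlane (upperHalfPlaneSet)

namespace Literature.Probability.RandomPlanarGeometry

/-! ### A holomorphic square root of a non-vanishing conformal map of `ℍ` -/

/-- **A continuous logarithm of a holomorphic function is holomorphic** (on an open set): locally
`f = f(z₀) + Log (g · e^{-f(z₀)})` with the principal branch. (Same argument as
`differentiableOn_of_cexp_eq` of `Literature/NumberTheory/ModularForms/LogLambda`.) [folklore] -/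
theorem differentiableOn_of_exp_comp_eq {U : Set ℂ} {f g : ℂ → ℂ} (hf : ContinuousOn f U)
    (hg : DifferentiableOn ℂ g U) (he : ∀ z ∈ U, exp (f z) = g z) : DifferentiableOn ℂ f U := by
  intro z₀ hz₀
  set w₀ := f z₀ with hw₀
  have key : ∀ᶠ z in 𝓝[U] z₀, f z = w₀ + log (g z * exp (-w₀)) := by
    have hc : ContinuousWithinAt (fun z ↦ f z - w₀) U z₀ := (hf z₀ hz₀).sub continuousWithinAt_const
    have hsmall : ∀ᶠ z in 𝓝[U] z₀, ‖f z - w₀‖ < Real.pi := by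
      have ht := hc.tendsto
      rw [show f z₀ - w₀ = 0 by simp [hw₀]] at ht
      filter_upwards [ht (Metric.ball_mem_nhds (0 : ℂ) Real.pi_pos)] with z hz
      simpa using hz
    filter_upwards [hsmall, self_mem_nhdsWithin] with z hz hzU
    have hprod : g z * exp (-w₀) = exp (f z - w₀) := by
      rw [sub_eq_add_neg, Complex.exp_add, he z hzU]
    rw [hprod, Complex.log_exp (by linarith [neg_abs_le (f z - w₀).im, (abs_im_le_norm _).trans_lt hz])
      (by linarith [le_abs_self (f z - w₀).im, (abs_im_le_norm _).trans_lt hz])]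
    ring
  have hd : DifferentiableWithinAt ℂ (fun z ↦ w₀ + log (g z * exp (-w₀))) U z₀ := by
    refine (differentiableWithinAt_const _).add (((hg z₀ hz₀).mul
      (differentiableWithinAt_const _)).clog ?_)
    change g z₀ * exp (-w₀) ∈ slitPlane
    rw [show g z₀ * exp (-w₀) = 1 by
      rw [← he z₀ hz₀, ← Complex.exp_add, add_neg_cancel, Complex.exp_zero]]
    exact one_mem_slitPlane
  exact hd.congr_of_eventuallyEq key (key.self_of_nhdsWithin hz₀)

/-- **Koebe's square root.** A holomorphic function on the (simply connected) upper half-plane that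
does not vanish has a holomorphic square root: `exp (L/2)` for a continuous — hence holomorphic —
logarithm `L` (Mathlib's `Complex.exists_continuousOn_eqOn_exp_comp`). Ahlfors (1979), Ch. 6 §1.1.
[cite: AhlforsCA1979, Ch. 6 §1.1] -/
theorem exists_differentiableOn_sq_eq {g : ℂ → ℂ} (hg : DifferentiableOn ℂ g upperHalfPlaneSet)
    (h0 : ∀ z ∈ upperHalfPlaneSet, g z ≠ 0) :
    ∃ r : ℂ → ℂ, DifferentiableOn ℂ r upperHalfPlaneSet ∧ ∀ z ∈ upperHalfPlaneSet, r z ^ 2 = g z := by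
  obtain ⟨L, hLc, hLe⟩ := Complex.exists_continuousOn_eqOn_exp_comp isSimplyConnected_upperHalfPlaneSet
    UpperHalfPlane.isOpen_upperHalfPlaneSet hg.continuousOn (by
      rintro ⟨z, hz, hz0⟩
      exact h0 z hz hz0)
  have hLd : DifferentiableOn ℂ L upperHalfPlaneSet :=
    differentiableOn_of_exp_comp_eq hLc hg fun z hz ↦ hLe hz
  refine ⟨fun z ↦ exp (L z / 2), (hLd.div_const 2).cexp, fun z hz ↦ ?_⟩
  rw [sq, ← Complex.exp_add, add_halves]
  exact hLe hz

/-! ### The boundary cover -/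

section Cover

set_option quotPrecheck false in
/-- The square-root preimage of the forward half `{0} ∪ η([0, ∞))` of the closed arm. -/
local notation "Sfw(" η ")" => {v : ℂ | v ^ 2 ∈ insert (0 : ℂ) (η '' Ici (0 : ℝ))}

set_option quotPrecheck false in
/-- The square-root preimage of the backward half of the closed arm in the coordinate `u = 1/v`:
`{u | u² ∈ {0} ∪ 1/η((-∞, 0])}`. -/
local notation "Sbw(" η ")" =>
  {u : ℂ | u ^ 2 ∈ insert (0 : ℂ) ((fun s : ℝ ↦ (η (-s))⁻¹) '' Ici (0 : ℝ))}

set_option quotPrecheck false in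
/-- The boundary cover: `M(Sfw) ∪ h(Sbw)` with `M(v) = 1/(v - p)`, `h(u) = u/(1 - p u) = M(1/u)`. -/
local notation "Cov(" η ", " p ")" =>
  ((fun v : ℂ ↦ (v - p)⁻¹) '' Sfw(η) ∪ (fun u : ℂ ↦ u / (1 - p * u)) '' Sbw(η))

variable {η : ℝ → ℂ} {p : ℂ}

/-- Points of `Sfw` are not the pole `p` (as `p² ∉ {0} ∪ η`). [folklore] -/
theorem ne_of_mem_sfw (hp : p ^ 2 ∉ insert (0 : ℂ) (range η)) {v : ℂ} (hv : v ∈ Sfw(η)) : v ≠ p := by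
  rintro rfl
  refine hp ?_
  rcases hv with h | ⟨t, -, ht⟩
  · exact Or.inl h
  · exact Or.inr ⟨t, ht⟩

/-- Points of `Sbw` have `1 - p u ≠ 0` (else `(1/u)² ∈ η` and `1/u = p`). [folklore] -/
theorem one_sub_mul_ne_zero_of_mem_sbw (hp : p ^ 2 ∉ insert (0 : ℂ) (range η)) {u : ℂ}
    (hu : u ∈ Sbw(η)) : 1 - p * u ≠ 0 := by
  intro h
  have hpu : p * u = 1 := by linear_combination -h
  have hu0 : u ≠ 0 := right_ne_zero_of_mul_eq_one hpu
  have hpeq : p = u⁻¹ := eq_inv_of_mul_eq_one_left hpu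
  rcases hu with h0 | ⟨s, -, hs⟩
  · exact hu0 (pow_eq_zero_iff two_ne_zero |>.1 h0)
  · refine hp (Or.inr ⟨-s, ?_⟩)
    rw [hpeq, inv_pow, ← hs, inv_inv]

/-- `u ↦ u / (1 - p u)` is injective where defined. [folklore] -/
theorem moebius_injOn (p : ℂ) : InjOn (fun u : ℂ ↦ u / (1 - p * u)) {u | 1 - p * u ≠ 0} := by
  intro u hu u' hu' h
  have h' : u * (1 - p * u') = u' * (1 - p * u) := by
    simp only at h
    rwa [div_eq_div_iff hu hu'] at h
  linear_combination h'

/-- **The boundary cover is compact and uniformly locally connected.** For a continuous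
`η : ℝ → ℂ` with `η(+∞) = 0`, `η(-∞) = ∞`, `0 ∉ η(ℝ)` and a pole `p` with `p² ∉ {0} ∪ η(ℝ)`: the forward
half `{0} ∪ η([0, ∞))` is a compact curve through `0`
(`Literature.Topology.PlaneTopology.exists_continuousOn_Icc_of_tendsto_atTop`), so its square-root
preimage is compact and uniformly locally connected
(`Literature.Topology.PlaneTopology.IsUniformlyLocallyConnected.setOf_sq_mem_image_Icc`), and so
is its image under the continuous injective `v ↦ 1/(v - p)`
(`isUniformlyLocallyConnected_image_of_isCompact`); likewise the backward half in the coordinate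
`u = 1/v` (the compact curve `{0} ∪ 1/η((-∞, 0])` through `0`) under `u ↦ u/(1 - p u)`; the union
of the two compact pieces is uniformly locally connected
(`Literature.Topology.PlaneTopology.IsUniformlyLocallyConnected.union`). Pommerenke (1992), §2.2.
[cite: PommerenkeBBCM1992, §2.2] -/
theorem isCompact_and_isUniformlyLocallyConnected_cover (hc : Continuous η)
    (htop : Tendsto η atTop (𝓝 0)) (hbot : Tendsto η atBot (cocompact ℂ)) (hne : ∀ t, η t ≠ 0)
    (hp : p ^ 2 ∉ insert (0 : ℂ) (range η)) :
    IsCompact Cov(η, p) ∧ Literature.Topology.PlaneTopology.IsUniformlyLocallyConnected Cov(η, p) := by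
  -- the forward half
  obtain ⟨c₁, hc₁, himg₁, -, -⟩ :=
    Literature.Topology.PlaneTopology.exists_continuousOn_Icc_of_tendsto_atTop hc.continuousOn htop
  have h0₁ : (0 : ℂ) ∈ c₁ '' Icc 0 1 := by rw [himg₁]; exact mem_insert _ _
  have hS₁K : IsCompact Sfw(η) := by
    rw [← himg₁]
    exact Literature.Topology.PlaneTopology.isCompact_setOf_sq_mem (isCompact_Icc.image_of_continuousOn hc₁)
  have hS₁U : Literature.Topology.PlaneTopology.IsUniformlyLocallyConnected Sfw(η) := by
    rw [← himg₁]
    exact Literature.Topology.PlaneTopology.IsUniformlyLocallyConnected.setOf_sq_mem_image_Icc hc₁ h0₁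
  have hMc : ContinuousOn (fun v : ℂ ↦ (v - p)⁻¹) Sfw(η) :=
    (continuousOn_id.sub continuousOn_const).inv₀ fun v hv ↦ sub_ne_zero.2 (ne_of_mem_sfw hp hv)
  have hMi : InjOn (fun v : ℂ ↦ (v - p)⁻¹) Sfw(η) := fun v _ v' _ h ↦ by
    simpa using h
  have hA : IsCompact ((fun v : ℂ ↦ (v - p)⁻¹) '' Sfw(η)) ∧
      Literature.Topology.PlaneTopology.IsUniformlyLocallyConnected ((fun v : ℂ ↦ (v - p)⁻¹) '' Sfw(η)) :=
    ⟨hS₁K.image_of_continuousOn hMc, isUniformlyLocallyConnected_image_of_isCompact hS₁U hS₁K hMc hMi⟩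
  -- the backward half in the coordinate `u = 1/v`
  have hgc : ContinuousOn (fun s : ℝ ↦ (η (-s))⁻¹) (Ici 0) :=
    ((hc.comp continuous_neg).inv₀ fun s ↦ hne (-s)).continuousOn
  have hg0 : Tendsto (fun s : ℝ ↦ (η (-s))⁻¹) atTop (𝓝 0) := by
    have h1 : Tendsto (fun s : ℝ ↦ η (-s)) atTop (cocompact ℂ) := hbot.comp tendsto_neg_atTop_atBot
    rw [← cobounded_eq_cocompact] at h1
    exact Filter.tendsto_inv₀_cobounded.comp h1
  obtain ⟨c₂, hc₂, himg₂, -, -⟩ :=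
    Literature.Topology.PlaneTopology.exists_continuousOn_Icc_of_tendsto_atTop hgc hg0
  have h0₂ : (0 : ℂ) ∈ c₂ '' Icc 0 1 := by rw [himg₂]; exact mem_insert _ _
  have hS₂K : IsCompact Sbw(η) := by
    rw [← himg₂]
    exact Literature.Topology.PlaneTopology.isCompact_setOf_sq_mem (isCompact_Icc.image_of_continuousOn hc₂)
  have hS₂U : Literature.Topology.PlaneTopology.IsUniformlyLocallyConnected Sbw(η) := by
    rw [← himg₂]
    exact Literature.Topology.PlaneTopology.IsUniformlyLocallyConnected.setOf_sq_mem_image_Icc hc₂ h0₂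
  have hhc : ContinuousOn (fun u : ℂ ↦ u / (1 - p * u)) Sbw(η) :=
    continuousOn_id.div (continuousOn_const.sub (continuousOn_const.mul continuousOn_id))
      fun u hu ↦ one_sub_mul_ne_zero_of_mem_sbw hp hu
  have hhi : InjOn (fun u : ℂ ↦ u / (1 - p * u)) Sbw(η) :=
    (moebius_injOn p).mono fun u hu ↦ one_sub_mul_ne_zero_of_mem_sbw hp hu
  have hB : IsCompact ((fun u : ℂ ↦ u / (1 - p * u)) '' Sbw(η)) ∧
      Literature.Topology.PlaneTopology.IsUniformlyLocallyConnected ((fun u : ℂ ↦ u / (1 - p * u)) '' Sbw(η)) :=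
    ⟨hS₂K.image_of_continuousOn hhc, isUniformlyLocallyConnected_image_of_isCompact hS₂U hS₂K hhc hhi⟩
  exact ⟨hA.1.union hB.1, hA.2.union hB.2 hA.1 hB.1⟩

/-- **The cover contains the images of all square roots of the closed arm.** If
`v² ∈ {0} ∪ η(ℝ)` then `1/(v - p) ∈ Cov`: for `v² ∈ {0} ∪ η([0, ∞))` directly; for `v² = η(t)`,
`t ≤ 0`, through `u = 1/v`, `u² = 1/η(t)` and `u/(1 - p u) = 1/(v - p)`. [folklore] -/
theorem mem_cover_of_sq_mem (hne : ∀ t, η t ≠ 0) {v : ℂ} (hv : v ^ 2 ∈ insert (0 : ℂ) (range η)) :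
    (v - p)⁻¹ ∈ Cov(η, p) := by
  rcases hv with h0 | ⟨t, ht⟩
  · exact Or.inl ⟨v, Or.inl h0, rfl⟩
  · rcases le_total 0 t with ht0 | ht0
    · exact Or.inl ⟨v, Or.inr ⟨t, ht0, ht⟩, rfl⟩
    · have hv0 : v ≠ 0 := by
        rintro rfl
        exact hne t (by rw [ht]; ring)
      refine Or.inr ⟨v⁻¹, Or.inr ⟨-t, neg_nonneg.2 ht0, ?_⟩, ?_⟩
      · change (η (- -t))⁻¹ = v⁻¹ ^ 2
        rw [neg_neg, ht, inv_pow]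
      · change v⁻¹ / (1 - p * v⁻¹) = (v - p)⁻¹
        have hvp : v - p = v * (1 - p * v⁻¹) := by
          rw [mul_sub, mul_one, mul_comm p v⁻¹, ← mul_assoc, mul_inv_cancel₀ hv0, one_mul]
        rw [hvp, mul_inv, div_eq_mul_inv]

/-- `0` is in the cover (`0 = 0 / (1 - p·0)` with `0 ∈ Sbw`). [folklore] -/
theorem zero_mem_cover : (0 : ℂ) ∈ Cov(η, p) :=
  Or.inr ⟨0, Or.inl (by norm_num), by simp⟩

end Cover

end Literature.Probability.RandomPlanarGeometry
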